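/-
Origin: expansion seat `planner-pub-hodgecm-mc-sanity-1-0`, handover #7 2026-08-18T19:35Z md5 a42b3b31a4ac (NEW additive leaf, 192 l.; imports Sanity.PointwiseRecord (row 10) + Sanity.Toy3Cores (row 2); install after those) (`HOME/mc/pub-hodgecm-mc-sanity-1/lean/LevelMeetToys.lean`, md5 a42b3b31, 192 lines);
landed by the packager successor (mc-unitary-1-g3, gen-8 kit) in gate run 32 as `HodgeCM/Model/Sanity/LevelMeetToys.lean` (verbatim).
-/
/-
Copyright: pub-hodgecm MODEL-CONSTRUCTION cell, 2026-08-18. Seat planner-pub-hodgecm-mc-sanity-1-0 (node SAN: toy-instance /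
degenerate-instance sanity, OFF the E2 path). KERNEL ONLY: 0 records, 0 cited hypotheses, 0 proof holes.

# LEVEL-MEETING (E3's C1-replacement) — diagonal triviality, and the toy profile of the E3 record

Intended install path `HodgeCM/Model/Sanity/LevelMeetToys.lean` (additive leaf). Imports the END-STATE owner's E3 leaf
`HodgeCM.Model.EndStateLevelMeet` (prl1-g11, md5 65a4a1915c67) through `Sanity/PointwiseRecord.lean` (this seat, #6) and
the toy cores `Sanity/Toy3Cores.lean` (this seat, #1); nothing restated, no new axioms.

§1 (any universe, any theta model): `ThetaModel.levelMeet_diag` — the conclusion of `LevelMeetAt V c` holds OUTRIGHT for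
a pair of wedge-functions at the SAME level (take that level and the four classes themselves); hence
`ThetaModel.levelMeetAt_iff_offDiag` — level-meeting has content only for pairs of DISTINCT levels `Γ₁ ≠ Γ₂`, i.e. only
through the level-DEPENDENCE of `(U.pms, T.emb)`.

§2 (toy universe `toyUniverse₃ d t`, whose period surfaces `U.pms L ι₁ V Γ` do not depend on `Γ`): every LEVEL-BLIND theta
model (`T.emb Γ₁ = T.emb Γ₂`) satisfies `LevelMeetAt` at every context — `levelMeetAt_of_levelBlind₃`; rows for the toy
model of record `thetaModel₃` and the two sanity cores `nullCore₃`, `gramCore₃ J`.  So on the toys the new E3 field is ✓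
unconditionally (non-vacuously but trivially), exactly like C1 was (`cover = id`).

§3 (toy profile of the E3 RECORD `AllCharsNonDesignPt₁ (finrank = 6)`): ✗ for BOTH toy cores and ANY transfer `J` — the
gating by good SEXTIC contexts does not rescue them, because a good sextic context exists in every universe
(`exists_signRecipe_goodCtx_sextic`) and at such a context C2 (null core) resp. C2 ∧ C5 (Gram core) fail for the same
Gram-vector reason as for the global record (`Toy3Cores.not_nullCore₃_innerEmb`, `not_gramCore₃_allCharsNonDesign`).
-/
import Summits.HodgeConjecture.HodgeCM.Model.Sanity.PointwiseRecord
import Summits.HodgeConjecture.HodgeCM.Model.Sanity.Toy3Cores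

set_option autoImplicit false

noncomputable section

open HodgeCM HodgeCM.Universe HodgeCM.ToyG2 HodgeCM.ToyG2.ThetaUiso MeasureTheory
open scoped InnerProductSpace
open Literature.AlgebraicGeometry.Motives (HodgeStructure)
open Literature.AlgebraicGeometry.Motives.HodgeStructure (conj)

attribute [-instance] Quotient.instMeasurableSpace

/-! ## §1 The diagonal of level-meeting is automatic -/

namespace HodgeCM.Universe.ThetaModel

variable {U : Universe} (T : U.ThetaModel) {L : CMField} {ι₁ : L →+* ℂ} (V : HermSpace3 L ι₁) (c : SeesawCtx L)

/-- **Same-level pairs meet trivially**: the conclusion of `LevelMeetAt V c` for two wedge-functions at ONE level `Γ`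
(witness: `Γ` itself and the four classes). -/
theorem levelMeet_diag (Γ : Level V) (ω₁ ω₂ ω₃ ω₄ : U.CohC (U.pms L ι₁ V Γ) 1)
    (h₁ : ω₁ ∈ U.Uiso Γ c.K (c.Ψ 0) c.σ) (h₂ : ω₂ ∈ U.Uiso Γ c.K (c.Ψ 1) c.σ)
    (h₃ : ω₃ ∈ U.Uiso Γ c.K (c.Ψ 2) c.σ) (h₄ : ω₄ ∈ U.Uiso Γ c.K (c.Ψ 3) c.σ)
    (hne : ⟪T.Λ Γ ω₃ ω₄, T.Λ Γ ω₁ ω₂⟫_ℂ ≠ 0) :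
    ∃ (Γ' : Level V) (ω : Fin 4 → U.CohC (U.pms L ι₁ V Γ') 1),
      (∀ i, ω i ∈ U.Uiso Γ' c.K (c.Ψ i) c.σ) ∧ ⟪T.Λ Γ' (ω 2) (ω 3), T.Λ Γ' (ω 0) (ω 1)⟫_ℂ ≠ 0 :=
  ⟨Γ, ![ω₁, ω₂, ω₃, ω₄], fun i => by fin_cases i; exacts [h₁, h₂, h₃, h₄], hne⟩

/-- **Level-meeting has content only OFF the diagonal** (`Γ₁ ≠ Γ₂`), i.e. only through the level-dependence of the
period surfaces and of `emb`. -/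
theorem levelMeetAt_iff_offDiag : T.LevelMeetAt V c ↔
    ∀ (Γ₁ Γ₂ : Level V), Γ₁ ≠ Γ₂ →
      ∀ (ω₁ ω₂ : U.CohC (U.pms L ι₁ V Γ₁) 1) (ω₃ ω₄ : U.CohC (U.pms L ι₁ V Γ₂) 1),
        ω₁ ∈ U.Uiso Γ₁ c.K (c.Ψ 0) c.σ → ω₂ ∈ U.Uiso Γ₁ c.K (c.Ψ 1) c.σ →
        ω₃ ∈ U.Uiso Γ₂ c.K (c.Ψ 2) c.σ → ω₄ ∈ U.Uiso Γ₂ c.K (c.Ψ 3) c.σ →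
        ⟪T.Λ Γ₂ ω₃ ω₄, T.Λ Γ₁ ω₁ ω₂⟫_ℂ ≠ 0 →
        ∃ (Γ : Level V) (ω : Fin 4 → U.CohC (U.pms L ι₁ V Γ) 1),
          (∀ i, ω i ∈ U.Uiso Γ c.K (c.Ψ i) c.σ) ∧ ⟪T.Λ Γ (ω 2) (ω 3), T.Λ Γ (ω 0) (ω 1)⟫_ℂ ≠ 0 := by
  refine ⟨fun H Γ₁ Γ₂ _ => H Γ₁ Γ₂, fun H Γ₁ Γ₂ ω₁ ω₂ ω₃ ω₄ h₁ h₂ h₃ h₄ hne => ?_⟩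
  by_cases hΓ : Γ₁ = Γ₂
  · subst hΓ
    exact T.levelMeet_diag V c Γ₁ ω₁ ω₂ ω₃ ω₄ h₁ h₂ h₃ h₄ hne
  · exact H Γ₁ Γ₂ hΓ ω₁ ω₂ ω₃ ω₄ h₁ h₂ h₃ h₄ hne

end HodgeCM.Universe.ThetaModel

/-! ## §2 Toys: the period surfaces of `toyUniverse₃` are level-blind, so every level-blind model meets -/

namespace HodgeCM.Sanity.Toy3

variable (d t : ℚ) (hd : (1 : ℚ) ≤ d) (ht : t ^ 2 = 16) (hP : PrintFact_unitaryCompact) (h : Bool)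
variable (d12 d34 : ∀ {L : CMField}, SeesawCtx L → SideData L)

/-- The toy's period surface `U.pms L ι₁ V Γ` does not depend on the level (nor on `V`). -/
theorem pms₃_level_irrel {L : CMField} {ι₁ : L →+* ℂ} (V : HermSpace3 L ι₁) (Γ₁ Γ₂ : Level V) :
    (toyUniverse₃ d t).pms L ι₁ V Γ₁ = (toyUniverse₃ d t).pms L ι₁ V Γ₂ := rfl

/-- **Every LEVEL-BLIND theta model over `toyUniverse₃` satisfies level-meeting at every context** (reduce to the
diagonal: the wedge-function at `Γ₂` IS a wedge-function at `Γ₁`). -/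
theorem levelMeetAt_of_levelBlind₃ (T : (toyUniverse₃ d t).ThetaModel)
    (hT : ∀ {L : CMField} {ι₁ : L →+* ℂ} {V : HermSpace3 L ι₁} (Γ₁ Γ₂ : Level V), T.emb Γ₁ = T.emb Γ₂)
    {L : CMField} {ι₁ : L →+* ℂ} (V : HermSpace3 L ι₁) (c : SeesawCtx L) : T.LevelMeetAt V c := by
  intro Γ₁ Γ₂ ω₁ ω₂ ω₃ ω₄ h₁ h₂ h₃ h₄ hne
  rw [T.Λ_apply Γ₂, hT Γ₂ Γ₁] at hne
  exact T.levelMeet_diag V c Γ₁ ω₁ ω₂ ω₃ ω₄ h₁ h₂ h₃ h₄ hne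

/-- Row: the toy theta model of record `thetaModel₃` (`emb := hr3g_Lam`, the Gram map) meets at every context. -/
theorem thetaModel₃_levelMeetAt {L : CMField} {ι₁ : L →+* ℂ} (V : HermSpace3 L ι₁) (c : SeesawCtx L) :
    (thetaModel₃ d t hd ht).LevelMeetAt V c :=
  levelMeetAt_of_levelBlind₃ d t _ (fun _ _ => rfl) V c

/-- Row: the all-zero core meets (also an instance of `levelMeetAt_of_zeroEmb`). -/
theorem nullCore₃_levelMeetAt {L : CMField} {ι₁ : L →+* ℂ} (V : HermSpace3 L ι₁) (c : SeesawCtx L) :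
    ((nullCore₃ d t hP).thetaModel h d12 d34).LevelMeetAt V c :=
  levelMeetAt_of_levelBlind₃ d t _ (fun _ _ => rfl) V c

variable (J : Transfer hP)

/-- Row: the Gram core `gramCore₃ J` (`emb := J_V ∘ hr3g_Lam`) meets at every context, for ANY transfer `J`. -/
theorem gramCore₃_levelMeetAt {L : CMField} {ι₁ : L →+* ℂ} (V : HermSpace3 L ι₁) (c : SeesawCtx L) :
    ((gramCore₃ d t hd ht hP J).thetaModel h d12 d34).LevelMeetAt V c :=
  levelMeetAt_of_levelBlind₃ d t _ (fun _ _ => rfl) V c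

/-! ## §3 Toy profile of the E3 record `AllCharsNonDesignPt₁ (finrank = 6)`: ✗ for both cores -/

include hd ht in
/-- **The all-zero core is not an E3 witness (sextic class)**: at a good SEXTIC context (which exists), C2 at the levels
of `V` fails for `emb = 0` — the theta wedge `E₀ ∪ E₁ ∈ F²H²` has `tr_ℂ(η ∪ η̄) = 4‖Λ(E₀,E₁)‖² ≠ 0`. -/
theorem not_nullCore₃_allCharsNonDesignPt₁_sextic :
    ¬ ((nullCore₃ d t hP).thetaModel h d12 d34).AllCharsNonDesignPt₁ (fun c => Module.finrank ℚ c.K = 6) := by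
  intro A
  obtain ⟨F, ι₁, V, c, hc, h6⟩ :=
    AdelicThetaCore.exists_signRecipe_goodCtx_sextic (h := h) (nullCore₃ d t hP) d12 d34
  obtain ⟨j, hj, -⟩ := hc.forced
  have hm : ∀ i, ι₁.comp j ∈ (c.Ψ i).1 := fun i => hj ▸ hc.mem i
  obtain ⟨Γ⟩ := Level.nonempty V
  obtain ⟨a, ha, H⟩ :=
    A.innerEmb V c (((nullCore₃ d t hP).thetaModel_goodCtx_iff h d12 d34 ι₁ c).mpr hc) h6 Γ
  have hne : Λ ι₁ d t hd ht (thetaE d t ι₁ j c.Ψ hc.pairSum hm 0) (thetaE d t ι₁ j c.Ψ hc.pairSum hm 1) ≠ 0 :=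
    Λ_thetaE01_ne_zero d t ι₁ hd ht j c.Ψ hc.pairSum hm
  have hη : (toyUniverse₃ d t).cup2C ((toyUniverse₃ d t).pms F ι₁ V Γ) 1 (thetaE d t ι₁ j c.Ψ hc.pairSum hm 0)
      (thetaE d t ι₁ j c.Ψ hc.pairSum hm 1) ∈ ((toyUniverse₃ d t).hodge ((toyUniverse₃ d t).pms F ι₁ V Γ) 2).F 2 :=
    Universe.cup2C_mem_F2 (toyUniverse₃_modelAxioms_all d t) _
      (hr3_eCls_mem_H10 d t ι₁ Γ (qΨ ι₁ j c.Ψ hc.pairSum hm) 0) (hr3_eCls_mem_H10 d t ι₁ Γ (qΨ ι₁ j c.Ψ hc.pairSum hm) 1)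
  have hid := H _ _ hη hη
  have h0 : ((nullCore₃ d t hP).thetaModel h d12 d34).emb Γ ((toyUniverse₃ d t).cup2C ((toyUniverse₃ d t).pms F ι₁ V Γ) 1
      (thetaE d t ι₁ j c.Ψ hc.pairSum hm 0) (thetaE d t ι₁ j c.Ψ hc.pairSum hm 1)) = 0 := rfl
  rw [h0, inner_zero_left, hr3g_gram d t ι₁ Γ hd ht hη hη, hr3g_Lam_cup] at hid
  exact (mul_ne_zero ha (mul_ne_zero (by norm_num) (inner_self_ne_zero.mpr hne))) hid.symm

/-- **The Gram core is not an E3 witness (sextic class), for ANY transfer `J`**: at a good sextic context C2 makes `J_V`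
faithful on the Gram vector `Λ(E₀,E₁) ≠ 0` while C5 (zero kernels: `S₁₂^all = 0`) makes `J_V` kill it. -/
theorem not_gramCore₃_allCharsNonDesignPt₁_sextic :
    ¬ ((gramCore₃ d t hd ht hP J).thetaModel h d12 d34).AllCharsNonDesignPt₁ (fun c => Module.finrank ℚ c.K = 6) := by
  intro A
  obtain ⟨F, ι₁, V, c, hc, h6⟩ :=
    AdelicThetaCore.exists_signRecipe_goodCtx_sextic (h := h) (gramCore₃ d t hd ht hP J) d12 d34
  have hc' : ((gramCore₃ d t hd ht hP J).thetaModel h d12 d34).GoodCtx ι₁ c :=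
    ((gramCore₃ d t hd ht hP J).thetaModel_goodCtx_iff h d12 d34 ι₁ c).mpr hc
  obtain ⟨j, hj, -⟩ := hc.forced
  have hm : ∀ i, ι₁.comp j ∈ (c.Ψ i).1 := fun i => hj ▸ hc.mem i
  obtain ⟨Γ⟩ := Level.nonempty V
  -- C2 at level Γ of V: ⟪J Λ η', J Λ η⟫ = a · tr(η ∪ η̄') on F², a ≠ 0
  obtain ⟨a, ha, H⟩ := A.innerEmb V c hc' h6 Γ
  -- C5 at (V, c) with zero kernels: `emb` kills every theta wedge of the context
  have hkillAll := (AdelicThetaCore.gen12AllAt_iff_of_zeroKernelsAt h d12 d34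
    (((gramCore₃ d t hd ht hP J).zeroKernels_iff_forall_at).mp (gramCore₃_zeroKernels d t hd ht hP J) V c)).mp
    (A.thetaGen12All V c hc' h6)
  have h₁ : thetaE d t ι₁ j c.Ψ hc.pairSum hm 0 ∈ thetaSet₃ d t ι₁ V c 0 Γ := ⟨j, hc.pairSum, hm, hj, rfl⟩
  have h₂ : thetaE d t ι₁ j c.Ψ hc.pairSum hm 1 ∈ thetaSet₃ d t ι₁ V c 1 Γ := ⟨j, hc.pairSum, hm, hj, rfl⟩
  have hkill : J V (Λ ι₁ d t hd ht (thetaE d t ι₁ j c.Ψ hc.pairSum hm 0) (thetaE d t ι₁ j c.Ψ hc.pairSum hm 1)) = 0 := by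
    have h0 := hkillAll Γ _ _ h₁ h₂
    rwa [gramCore₃_emb, hr3g_Lam_cup] at h0
  have hne : Λ ι₁ d t hd ht (thetaE d t ι₁ j c.Ψ hc.pairSum hm 0) (thetaE d t ι₁ j c.Ψ hc.pairSum hm 1) ≠ 0 :=
    Λ_thetaE01_ne_zero d t ι₁ hd ht j c.Ψ hc.pairSum hm
  have hη : (toyUniverse₃ d t).cup2C ((toyUniverse₃ d t).pms F ι₁ V Γ) 1 (thetaE d t ι₁ j c.Ψ hc.pairSum hm 0)
      (thetaE d t ι₁ j c.Ψ hc.pairSum hm 1) ∈ ((toyUniverse₃ d t).hodge ((toyUniverse₃ d t).pms F ι₁ V Γ) 2).F 2 :=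
    Universe.cup2C_mem_F2 (toyUniverse₃_modelAxioms_all d t) _
      (hr3_eCls_mem_H10 d t ι₁ Γ (qΨ ι₁ j c.Ψ hc.pairSum hm) 0) (hr3_eCls_mem_H10 d t ι₁ Γ (qΨ ι₁ j c.Ψ hc.pairSum hm) 1)
  have hid := H _ _ hη hη
  have h0 : ((gramCore₃ d t hd ht hP J).thetaModel h d12 d34).emb Γ ((toyUniverse₃ d t).cup2C
      ((toyUniverse₃ d t).pms F ι₁ V Γ) 1 (thetaE d t ι₁ j c.Ψ hc.pairSum hm 0) (thetaE d t ι₁ j c.Ψ hc.pairSum hm 1)) = 0 := by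
    show J V (hr3g_Lam d t ι₁ Γ hd ht ((toyUniverse₃ d t).cup2C ((toyUniverse₃ d t).pms F ι₁ V Γ) 1
      (thetaE d t ι₁ j c.Ψ hc.pairSum hm 0) (thetaE d t ι₁ j c.Ψ hc.pairSum hm 1))) = 0
    rw [hr3g_Lam_cup]
    exact hkill
  rw [h0, inner_zero_left, hr3g_gram d t ι₁ Γ hd ht hη hη, hr3g_Lam_cup] at hid
  exact (mul_ne_zero ha (mul_ne_zero (by norm_num) (inner_self_ne_zero.mpr hne))) hid.symm

/-- **TOY PROFILE OF THE E3 RECORD**: the new field `levelMeet` is ✓ at every context for both cores and any `J`, and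
the record `AllCharsNonDesignPt₁ (finrank = 6)` is ✗ for both — level-meeting adds no non-degeneracy content; the toys
fail E3 exactly where they failed E2 (C2, resp. C2 ∧ C5). -/
theorem toyProfilePt₁ :
    (∀ {L : CMField} {ι₁ : L →+* ℂ} (V : HermSpace3 L ι₁) (c : SeesawCtx L),
        ((nullCore₃ d t hP).thetaModel h d12 d34).LevelMeetAt V c ∧
          ((gramCore₃ d t hd ht hP J).thetaModel h d12 d34).LevelMeetAt V c) ∧
      ¬ ((nullCore₃ d t hP).thetaModel h d12 d34).AllCharsNonDesignPt₁ (fun c => Module.finrank ℚ c.K = 6) ∧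
      ¬ ((gramCore₃ d t hd ht hP J).thetaModel h d12 d34).AllCharsNonDesignPt₁ (fun c => Module.finrank ℚ c.K = 6) :=
  ⟨fun V c => ⟨nullCore₃_levelMeetAt d t hP h d12 d34 V c, gramCore₃_levelMeetAt d t hd ht hP h d12 d34 J V c⟩,
    not_nullCore₃_allCharsNonDesignPt₁_sextic d t hd ht hP h d12 d34,
    not_gramCore₃_allCharsNonDesignPt₁_sextic d t hd ht hP h d12 d34 J⟩

end HodgeCM.Sanity.Toy3

end
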